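import Mathlib
import Summits.Ventures.PercRepro2.RBDefs
import Summits.Ventures.PercRepro2.RBRoot
import Summits.Ventures.PercRepro2.RBRootDefs
import Summits.Ventures.PercRepro2.RBRootEdge
import Summits.Ventures.PercRepro2.RBRootEdgePin
import Summits.Ventures.PercRepro2.RBRootEdgeMain
import Summits.Ventures.PercRepro2.RBRootEdgeT
import Summits.Ventures.PercRepro2.RBRootIsolated
import Summits.Ventures.PercRepro2.RBTwoMarkers
import Summits.Ventures.PercRepro2.RBTwoMarkersMain
import Summits.Ventures.PercRepro2.RBTwoMarkersCross
import Summits.Ventures.PercRepro2.RBTwoMarkersCrossMain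
import Summits.Ventures.PercRepro2.RBKernel
import Summits.Ventures.PercRepro2.RBParallel
import Summits.Ventures.PercRepro2.RBKernelDefs
import Summits.Ventures.PercRepro2.RBLeaf
import Summits.Ventures.PercRepro2.RBPruneDefs
import Summits.Ventures.PercRepro2.RBKernelLeaf
import Summits.Ventures.PercRepro2.RBSeries
import Summits.Ventures.PercRepro2.RBSeriesMain
import Summits.Ventures.PercRepro2.RBSeriesMass
import Summits.Ventures.PercRepro2.RBSeriesKernel
import Summits.Ventures.PercRepro2.RBReduceDefs
import Summits.Ventures.PercRepro2.RBPendantW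
import Summits.Ventures.PercRepro2.RBReduce

/-!
# The typed row at a third vertex pendant at a skeleton-reducible vertex (mine-a g6; MINE-A.md §38)

The packaged theorem `RB.RBcross_and_RBsame_of_reducible` (the row at every `w` whose marked
skeleton has `N(w) ⊆ {s, t, b, o}`) composed with the pendant-`w` reduction
`RB.RBcross_and_RBsame_of_pendant_w` (the slack at a pendant third vertex is `p_f` times the
slack at its neighbour): the row holds at every `w ∉ {s, t, b, o}` whose single nonzero-weight
edge `f = {w, u}` leads to a vertex `u` at which the weight vector is skeleton-reducible — in
words, at every third vertex whose marked skeleton is «`w` pendant at `u` with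
`N(u) ⊆ {s, t, b, o, w}`», the first class with an unmarked neighbour of skeleton degree `≥ 3`.
-/

namespace Summit.Ventures.PercRepro2

namespace RB

open scoped Classical

variable {V : Type*} {E : Type*} [Fintype E] [DecidableEq E] [Fintype V] [DecidableEq V]
  {R : Type*} [Field R] [LinearOrder R] [IsStrictOrderedRing R]

omit [DecidableEq V] in
/-- **The typed row at a third vertex pendant at a skeleton-reducible vertex**: `w ∉ {s, t, b, o}`
with the single nonzero-weight edge `f = {w, u}` (`u ≠ w`), and `p` skeleton-reducible at `u`. -/
theorem RBcross_and_RBsame_of_reducible_pendant_w {p : E → R} (hp : IsProbVec p)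
    (ends : E → Sym2 V) (o b s t w u : V) {f : E} (hends : ends f = s(w, u)) (huw : u ≠ w)
    (hws : w ≠ s) (hwt : w ≠ t) (hwb : w ≠ b) (hwo : w ≠ o)
    (huniq : ∀ e, w ∈ ends e → p e ≠ 0 → e = f) (hr : Reducible ends s t b o u p) :
    RBcross p ends o b s t w ∧ RBsame p ends o b s t w :=
  RBcross_and_RBsame_of_pendant_w hp ends o b s t w u hends huw hws hwt hwb hwo huniq
    (RBcross_and_RBsame_of_reducible hp ends o b s t u hr)

end RB

end Summit.Ventures.PercRepro2
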